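import Summits.KontsevichZagierPeriods.KontsevichZagierPeriods.Theorems.HurwitzMicroSectorsNormalFormPrincipleDilogExistsBoxAtoms
import Literature.NumberTheory.Transcendental.KZProductIdeal
import Literature.NumberTheory.Transcendental.KZDominatedFamilyRelations

/-!
# `NormalFormPrinciple` (stmt-KontsevichZagierPeriods-3869), line `SketchIdeator1` — the leaf
# `stub_boxRigidity` in dimension three, layer `M3`: the dimension drop of WeightDropTornheim

Registered sub-goal `wdt_wedge_sub_tau` of the layer `M3` (two transcendence-free dimension-three
instances of `stub_boxRigidity`; lead seat c9). In the instance WeightDropTornheim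
`[(0,1)³, 1/((1−xy)(1−xz))] ∼ [(0,1)², 2/(1−xy)]` the half-wedge representation
`W' = [V<, g]`, `V< = {0 < t₁ < t₂ < t₀ < 1}`, `g = 1/(t₀² (1 − t₁)(1 − t₂))`, and the two-dimensional
representation `T = [{0 < y₀ < y₁ < 1}, 1/(y₁ (1 − y₀))]` differ by a relation of the
Kontsevich–Zagier calculus: the coordinate `t₀` is integrated out,
`∫_{t₂}^{1} dt₀/(t₀² (1 − t₁)(1 − t₂)) = [−1/(t₀ (1 − t₁)(1 − t₂))]_{t₀ = t₂}^{1} = 1/(t₂ (1 − t₁))`.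
Chain of moves:

1. (rule 2) the cyclic coordinate permutation putting `t₀` last
   (`KZ.of_sub_of_reindex_mem_relations` along `(finRotate 3).symm`): the domain becomes
   `V = {0 < w₀ < w₁ < w₂ < 1}` and the integrand `1/(w₂² (1 − w₀)(1 − w₁))`;
2. (rule 1) null adjustment: the closed-fibre band `B = {(w₀, w₁) ∈ τ, w₁ ≤ w₂ ≤ 1}` over the base
   `τ = {0 < y₀ < y₁ < 1}` contains `V` and differs from it by the null pieces `{w₂ = w₁}`,
   `{w₂ = 1}` (`KZ.IntegralRep.of_sub_of_restrict_mem_relations`,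
   `KZ.of_sub_of_mem_relations_of_eqOn`);
3. (rule 3) ONE Newton–Leibniz move along `w₂ ∈ [w₁, 1]` over `τ` with the rational primitive
   `F = −1/(w₂ (1 − w₀)(1 − w₁))`, `∂F/∂w₂ = 1/(w₂² (1 − w₀)(1 − w₁))`, and
   `F(w₀, w₁, 1) − F(w₀, w₁, w₁) = 1/(w₁ (1 − w₀))`.

References: M. Kontsevich, D. Zagier, *Periods* (2001), §1.1–1.2, rules (1)–(3). No definitions
are introduced.
-/

noncomputable section

open MeasureTheory Set
open Literature.NumberTheory.Transcendental Literature.NumberTheory.Transcendental.KZ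
open Literature.ModelTheory.ExponentialFields (IsSemialgebraic)

namespace Summit.KontsevichZagierPeriods.HurwitzMicroSectors.NormalFormPrinciple.PiBox.M3

/-! ### The cyclic permutation, the band, the primitive -/

/-- The values of the cyclic permutation `(finRotate 3)⁻¹` of `Fin 3`: `0 ↦ 2`, `1 ↦ 0`, `2 ↦ 1`.
[folklore] -/
theorem wdt3_rot_apply :
    (finRotate 3).symm 0 = 2 ∧ (finRotate 3).symm 1 = 0 ∧ (finRotate 3).symm 2 = 1 := by
  decide

/-- Membership in the closed-fibre band `B = {(w₀, w₁) ∈ τ, w₁ ≤ w₂ ≤ 1}` over the base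
`τ = {0 < y₀ < y₁ < 1} ⊆ ℝ²`. [folklore] -/
theorem wdt3_mem_band {τ : Set (Fin 2 → ℝ)} (hτ : τ = {y | 0 < y 0 ∧ y 0 < y 1 ∧ y 1 < 1})
    {w : Fin 3 → ℝ} :
    w ∈ KZlog.band τ (fun y => y 1) (fun _ => (1:ℝ)) ↔
      (0 < w 0 ∧ w 0 < w 1 ∧ w 1 < 1) ∧ w 1 ≤ w 2 ∧ w 2 ≤ 1 := by
  rw [KZlog.mem_band, hτ]
  exact Iff.rfl

/-- The fibrewise derivative of the primitive `s ↦ −1/(s p q)` is `1/(s² p q)` away from `s = 0`.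
[folklore] -/
theorem wdt3_hasDerivAt (p q : ℝ) {t : ℝ} (ht : t ≠ 0) :
    HasDerivAt (fun s : ℝ => -1 / (s * p * q)) (1 / (t ^ 2 * p * q)) t := by
  have h := (hasDerivAt_inv ht).const_mul (-1 / (p * q))
  have hfun : (fun s : ℝ => -1 / (s * p * q)) = fun s => -1 / (p * q) * s⁻¹ := by
    funext s
    ring
  rw [hfun]
  exact h.congr_deriv (by ring)

/-! ### The stub -/

/-- **T3a (the dimension drop of WeightDropTornheim; registered sub-goal of the layer `M3` of
`stub_boxRigidity`).** The half-wedge representation `W' = [{0 < t₁ < t₂ < t₀ < 1},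
1/(t₀² (1 − t₁)(1 − t₂))]` and the two-dimensional representation
`T = [{0 < y₀ < y₁ < 1}, 1/(y₁ (1 − y₀))]` differ by a relation: rotate the coordinates so that
`t₀` comes last (rule 2), adjust the two null faces `{w₂ = w₁}`, `{w₂ = 1}` of the closed-fibre
band over `τ = {0 < y₀ < y₁ < 1}` (rule 1), and make ONE Newton–Leibniz move along
`w₂ ∈ [w₁, 1]` with the rational primitive `−1/(w₂ (1 − w₀)(1 − w₁))` (rule 3), whose endpoint
difference is `1/(y₁ (1 − y₀))`. [cite: KontsevichZagier2001, §1.2 rules (1)–(3)] -/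
theorem wdt_wedge_sub_tau :
    ∀ (W' : IntegralRep 3) (T : IntegralRep 2),
      W'.domain = {t | 0 < t 1 ∧ t 1 < t 2 ∧ t 2 < t 0 ∧ t 0 < 1} →
      EqOn W'.integrand (fun t => 1 / (t 0 ^ 2 * (1 - t 1) * (1 - t 2))) W'.domain →
      T.domain = {y | 0 < y 0 ∧ y 0 < y 1 ∧ y 1 < 1} →
      EqOn T.integrand (fun y => 1 / (y 1 * (1 - y 0))) T.domain →
      of W' - of T ∈ relations := by
  intro W' T hW'd hW'i hTd hTi
  -- the base `τ = T.domain = {0 < y₀ < y₁ < 1} ⊆ ℝ²`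
  have hτ : IsSemialgebraic ℚ T.domain := T.isSemialgebraic_domain
  have hmemτ : ∀ y : Fin 2 → ℝ, y ∈ T.domain ↔ 0 < y 0 ∧ y 0 < y 1 ∧ y 1 < 1 := fun y => by
    rw [hTd]
    exact Iff.rfl
  have hmemW' : ∀ t : Fin 3 → ℝ, t ∈ W'.domain ↔ 0 < t 1 ∧ t 1 < t 2 ∧ t 2 < t 0 ∧ t 0 < 1 :=
    fun t => by
    rw [hW'd]
    exact Iff.rfl
  have he := wdt3_rot_apply
  -- membership in the rotated wedge `V = {0 < w₀ < w₁ < w₂ < 1}` and in the band `B`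
  have hmemV : ∀ w : Fin 3 → ℝ, w ∈ (W'.reindex (finRotate 3).symm).domain ↔
      0 < w 0 ∧ w 0 < w 1 ∧ w 1 < w 2 ∧ w 2 < 1 := fun w => by
    rw [IntegralRep.reindex_domain, mem_setOf_eq, hmemW']
    simp only [he.1, he.2.1, he.2.2]
  have hmemB : ∀ w : Fin 3 → ℝ, w ∈ KZlog.band T.domain (fun y => y 1) (fun _ => (1:ℝ)) ↔
      (0 < w 0 ∧ w 0 < w 1 ∧ w 1 < 1) ∧ w 1 ≤ w 2 ∧ w 2 ≤ 1 := fun w => wdt3_mem_band hTd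
  -- `V` is `ℚ`-semialgebraic, measurable, contained in `B`, and `B \ V` is null
  have hV : IsSemialgebraic ℚ (W'.reindex (finRotate 3).symm).domain :=
    (W'.reindex (finRotate 3).symm).isSemialgebraic_domain
  have hVm : MeasurableSet (W'.reindex (finRotate 3).symm).domain :=
    Literature.ModelTheory.ExponentialFields.IsSemialgebraic.measurableSet_holds hV
  have hVB : (W'.reindex (finRotate 3).symm).domain ⊆
      KZlog.band T.domain (fun y => y 1) (fun _ => (1:ℝ)) := fun w hw => by
    have h := (hmemV w).1 hw
    exact (hmemB w).2 ⟨⟨h.1, h.2.1, h.2.2.1.trans h.2.2.2⟩, h.2.2.1.le, h.2.2.2.le⟩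
  have hvolB : volume (KZlog.band T.domain (fun y => y 1) (fun _ => (1:ℝ)) \
      (W'.reindex (finRotate 3).symm).domain) = 0 := by
    refine measure_mono_null (fun w hw => ?_)
      (measure_union_null (volume_graph_eq_zero (isSemialgebraicFunOn_apply hτ 1))
        (volume_setOf_last_eq_zero (1:ℝ)))
    have hb := KZlog.mem_band.1 hw.1
    have h := (hmemB w).1 hw.1
    rcases h.2.1.lt_or_eq with h12 | h12
    · rcases h.2.2.lt_or_eq with h2 | h2
      · exact absurd ((hmemV w).2 ⟨h.1.1, h.1.2.1, h12, h2⟩) hw.2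
      · right
        show w 2 = 1
        exact h2
    · left
      refine ⟨hb.1, ?_⟩
      show w 2 = w 1
      exact h12.symm
  -- the rotated integrand `g = 1/(w₂² (1 − w₀)(1 − w₁))` on `V`, read off `W'`
  have hgV : ∀ w ∈ (W'.reindex (finRotate 3).symm).domain,
      (W'.reindex (finRotate 3).symm).integrand w = 1 / (w 2 ^ 2 * (1 - w 0) * (1 - w 1)) :=
    fun w hw => by
    have hw' : (fun i => w ((finRotate 3).symm i)) ∈ W'.domain := hw
    rw [IntegralRep.reindex_integrand]
    show W'.integrand (fun i => w ((finRotate 3).symm i)) = _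
    rw [hW'i hw']
    simp only [he.1, he.2.1, he.2.2]
  -- the band representation `R = [B, g]`
  have hB : IsSemialgebraic ℚ (KZlog.band T.domain (fun y => y 1) (fun _ => (1:ℝ))) :=
    KZlog.isSemialgebraic_band (isSemialgebraicFunOn_apply hτ 1)
      (by simpa using isSemialgebraicFunOn_ratCast hτ 1)
  have hden : ∀ w ∈ KZlog.band T.domain (fun y => y 1) (fun _ => (1:ℝ)),
      w 2 ≠ 0 ∧ (1:ℝ) - w 0 ≠ 0 ∧ (1:ℝ) - w 1 ≠ 0 := fun w hw => by
    have h := (hmemB w).1 hw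
    exact ⟨((h.1.1.trans h.1.2.1).trans_le h.2.1).ne', (sub_pos.2 (h.1.2.1.trans h.1.2.2)).ne',
      (sub_pos.2 h.1.2.2).ne'⟩
  have hg : IsSemialgebraicFunOn ℚ (KZlog.band T.domain (fun y => y 1) (fun _ => (1:ℝ)))
      (fun w => 1 / (w 2 ^ 2 * (1 - w 0) * (1 - w 1))) := by
    refine (isSemialgebraicFunOn_aeval_div_aeval hB 1
      (MvPolynomial.X 2 ^ 2 * (1 - MvPolynomial.X 0) * (1 - MvPolynomial.X 1))
      fun w hw => ?_).congr fun w _ => by simp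
    have h := hden w hw
    simp only [map_mul, map_pow, map_sub, map_one, MvPolynomial.aeval_X]
    exact mul_ne_zero (mul_ne_zero (pow_ne_zero 2 h.1) h.2.1) h.2.2
  have hintV : IntegrableOn (fun w : Fin 3 → ℝ => 1 / (w 2 ^ 2 * (1 - w 0) * (1 - w 1)))
      (W'.reindex (finRotate 3).symm).domain :=
    (W'.reindex (finRotate 3).symm).integrableOn.congr_fun hgV hVm
  have hint : IntegrableOn (fun w : Fin 3 → ℝ => 1 / (w 2 ^ 2 * (1 - w 0) * (1 - w 1)))
      (KZlog.band T.domain (fun y => y 1) (fun _ => (1:ℝ))) := by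
    rw [← union_sdiff_cancel hVB]
    exact hintV.union (IntegrableOn.of_measure_zero hvolB)
  obtain ⟨R, hRd, hRi⟩ : ∃ R : IntegralRep 3,
      R.domain = KZlog.band T.domain (fun y => y 1) (fun _ => (1:ℝ)) ∧
      R.integrand = fun w => 1 / (w 2 ^ 2 * (1 - w 0) * (1 - w 1)) :=
    ⟨⟨_, _, hB, hg, hint⟩, rfl, rfl⟩
  have hVR : (W'.reindex (finRotate 3).symm).domain ⊆ R.domain := by
    rw [hRd]
    exact hVB
  have hvolR : volume (R.domain \ (W'.reindex (finRotate 3).symm).domain) = 0 := by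
    rw [hRd]
    exact hvolB
  -- (1) rule 2: the rotation
  have hS := of_sub_of_reindex_mem_relations W' (finRotate 3).symm
  -- (2) rule 1: the null adjustment and the congruence on `V`
  have hres := IntegralRep.of_sub_of_restrict_mem_relations R hV hVR hvolR
  have hcmp : of (W'.reindex (finRotate 3).symm) - of (R.restrict _ hV hVR) ∈ relations := by
    refine of_sub_of_mem_relations_of_eqOn rfl fun w hw => ?_
    show (W'.reindex (finRotate 3).symm).integrand w = R.integrand w
    rw [hgV w hw, hRi]
  -- (3) rule 3: ONE Newton–Leibniz move along `w₂ ∈ [w₁, 1]` over `τ`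
  have hs0 : ∀ (x : Fin 2 → ℝ) (t : ℝ), (Fin.snoc x t : Fin 3 → ℝ) 0 = x 0 := fun _ _ => rfl
  have hs1 : ∀ (x : Fin 2 → ℝ) (t : ℝ), (Fin.snoc x t : Fin 3 → ℝ) 1 = x 1 := fun _ _ => rfl
  have hs2 : ∀ (x : Fin 2 → ℝ) (t : ℝ), (Fin.snoc x t : Fin 3 → ℝ) 2 = t := fun _ _ => rfl
  have hNL : of R - of T ∈ relations := by
    refine newtonLeibnizRel_subset_relations ⟨2, R, T, fun y => y 1, fun _ => (1:ℝ),
      fun w => -1 / (w 2 * (1 - w 0) * (1 - w 1)),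
      ?_, isSemialgebraicFunOn_apply hτ 1, (by simpa using isSemialgebraicFunOn_ratCast hτ 1),
      fun y hy => ((hmemτ y).1 hy).2.2.le, ?_, ?_, ?_, ?_, rfl⟩
    · -- the primitive is a quotient of `ℚ`-polynomials on the band
      rw [hRd]
      refine (isSemialgebraicFunOn_aeval_div_aeval hB (-1)
        (MvPolynomial.X 2 * (1 - MvPolynomial.X 0) * (1 - MvPolynomial.X 1))
        fun w hw => ?_).congr fun w _ => by simp
      have h := hden w hw
      simp only [map_mul, map_sub, map_one, MvPolynomial.aeval_X]
      exact mul_ne_zero (mul_ne_zero h.1 h.2.1) h.2.2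
    · -- the band over `τ` with edges `w₁ ≤ w₂ ≤ 1`
      rw [hRd]
      rfl
    · -- continuity of the primitive on the closed fibre `[y₁, 1] ⊆ (0, ∞)`
      intro y hy
      have hy' := (hmemτ y).1 hy
      simp only [hs0, hs1, hs2]
      refine ContinuousOn.div continuousOn_const (by fun_prop) fun t ht => ?_
      have ht0 : 0 < t := (hy'.1.trans hy'.2.1).trans_le ht.1
      exact mul_ne_zero (mul_ne_zero ht0.ne' (sub_pos.2 (hy'.2.1.trans hy'.2.2)).ne')
        (sub_pos.2 hy'.2.2).ne'
    · -- its derivative on the open fibre is the band integrand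
      intro y hy t ht
      have hy' := (hmemτ y).1 hy
      rw [hRi]
      simp only [hs0, hs1, hs2]
      exact wdt3_hasDerivAt (1 - y 0) (1 - y 1) ((hy'.1.trans hy'.2.1).trans ht.1).ne'
    · -- the endpoint difference is `1/(y₁ (1 − y₀))`
      intro y hy
      have hy' := (hmemτ y).1 hy
      have h0 : (1:ℝ) - y 0 ≠ 0 := (sub_pos.2 (hy'.2.1.trans hy'.2.2)).ne'
      have h1 : (1:ℝ) - y 1 ≠ 0 := (sub_pos.2 hy'.2.2).ne'
      have h1' : y 1 ≠ 0 := (hy'.1.trans hy'.2.1).ne'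
      rw [hTi hy]
      simp only [hs0, hs1, hs2]
      field_simp
      ring
  -- (4) bookkeeping
  have key : of W' - of T = (of W' - of (W'.reindex (finRotate 3).symm)) +
      (of (W'.reindex (finRotate 3).symm) - of (R.restrict _ hV hVR)) -
      (of R - of (R.restrict _ hV hVR)) + (of R - of T) := by
    abel
  rw [key]
  exact relations.add_mem (relations.sub_mem (relations.add_mem hS hcmp) hres) hNL

end Summit.KontsevichZagierPeriods.HurwitzMicroSectors.NormalFormPrinciple.PiBox.M3
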